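import Summits.QuantumFields.BalabanUV.T4Continuum.Support.CovariantAveragingBalaban
import Summits.QuantumFields.BalabanUV.T4Continuum.Support.LineAveragingPairingLaw
import Summits.QuantumFields.BalabanUV.T4Continuum.Support.CovariantBlockAveragingPairingLaw

/-!
# T⁴ programme, spine node NE2 (U1a) — BAŁABAN's COVARIANT-AVERAGING SUMMAND: THE TWO LAWS DISCHARGED BY NAME (tier B, row B3.b-inst
# of `t4/formal/NE2/LEAVES.md`, the 10-line corollary announced at CLAIMS.log l.6625)

NE2 formalisation swarm `b2b-balaban-t4-ne2-formalise-*`, leaf 01 (row B3.b-inst, file 3; companions `CovariantAveragingSummand` p208141,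
`CovariantAveragingBalaban` p208566).  The row's END `perturbationLaws_covariantAveraging_balaban` was landed GENERIC in the two
`AveragingLaws` it consumes.  Both are now tree theorems:
 * `hB` = row B3.a′ (leaf 06) **`LineAveragingPairing.averagingLaws_Bfree`** — the free line-averaging `Bfree` pairs through King's planting
   with the sandwiched defect `Cst·L^{−k}` (exact offset identity);
 * `hE` = rows B3.a ∧ B3.b-conc (iii) (leaf 07) **`CovariantBlockAveraging.averagingLaws_Ecov_of_bond`** — the transport error `Ecov` of the
   (1.7)-contour block averaging has size `ε = card o·(e^{(d+1)α} − 1)` and sandwiched pairings `Cst·card o·(θ₀ + ε/card o)·L^{−k}` from the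
   bond-level data: `‖R_k − 1‖ ≤ α/n_k` and the two-level consistency `θ k ≤ θ₀L^{−k}` of the contour transporters (node NE3's currency).
Hence **`perturbationLaws_covariantAveraging_balaban_of_bond`** (no `AveragingLaws` binder left; `κ_Q`, `C₂^Q` explicit in `α, θ₀`) and the
physical value `t = 1` **`covariantAveraging_balaban_rate_of_bond`** under the DISPLAYED threshold `a·ε(2 + ε)·Cst(d,a) < 1`.

HONEST FRAMING (T4-DAG p. 1).  Model level ((α) instance of referee c8: King's line-sum inner averaging `QvOp ⊗ 1`, transporters DATA), GLOBAL
small field, finite torus, linear layer, operator norm; row B3's `aQ*Q` summand only (rows B2/B4 carry the others); NOT [B9] (3.23)–(3.26) as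
printed; no dictionary (B0); NE2 NOT proved; spine count 0/9 UNCHANGED; NOT infinite volume / mass gap / Clay.  HONEST DEPENDENCY LINE:
continuum YM on T⁴ ⇐ BetaPertH ∧ nine spine estimates (0/9 proved); BetaPertH ⇐ (D1) ∧ (D4) ∧ CAP+tail; G-an2-4 gates asym, D1 and NE2/3/4.
ABSOLUTE RULE kept; no `sorry`.
-/

noncomputable section

open scoped BigOperators ComplexConjugate Matrix Matrix.Norms.L2Operator Kronecker

namespace Summit.QuantumFields.BalabanUV.T4Continuum.CovariantAveragingBalaban

open Literature.MathematicalPhysics.QuantumFieldTheory.Balaban1983to89.B5Prop11Plancherel (Tor fine Cst Cst_nonneg)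
open Literature.MathematicalPhysics.QuantumFieldTheory.Balaban1983to89.B5Block118 (QvOp)
open Literature.MathematicalPhysics.QuantumFieldTheory.Balaban1983to89.B5G183RateUnitTower (lev lev_neZero)
open Summit.QuantumFields.BalabanUV.T4Continuum
open Summit.QuantumFields.BalabanUV.T4Continuum.CovariantAveragingTower (TowerLimitRate)
open Summit.QuantumFields.BalabanUV.T4Continuum.BalabanAveragedTowerUnit (idx Qlev)
open Summit.QuantumFields.BalabanUV.T4Continuum.BackgroundResolventTower
open Summit.QuantumFields.BalabanUV.T4Continuum.KingPairingPlantedLaw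
open Summit.QuantumFields.BalabanUV.T4Continuum.NE2PerturbedLayer
open Summit.QuantumFields.BalabanUV.T4Continuum.GramPerturbationLaw
open Summit.QuantumFields.BalabanUV.T4Continuum.CovariantAveragingSummand (kappaQ kappaQ_ofReal)
open Summit.QuantumFields.BalabanUV.T4Continuum.CovariantBlockAveraging (QcovLev Ecov ctr averagingLaws_Ecov_of_bond)
open Summit.QuantumFields.BalabanUV.T4Continuum.LineAveragingPairing (glue averagingLaws_Bfree)

variable {d : ℕ} (L : ℕ) [NeZero L] (M : Fin d → ℕ) [hM : ∀ μ, NeZero (M μ)] (a : ℝ) (ha : 0 < a)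
variable (o : Type*) [Fintype o] [DecidableEq o]

omit [DecidableEq o] in
/-- the size of the transport error is nonnegative: `0 ≤ ε(α) = card o·(e^{(d+1)α} − 1)`. [folklore] -/
theorem epsB_nonneg (d : ℕ) {α : ℝ} (hα : 0 ≤ α) : 0 ≤ Fintype.card o * (Real.exp ((d + 1 : ℕ) * α) - 1) :=
  mul_nonneg (Nat.cast_nonneg _) (sub_nonneg.mpr (Real.one_le_exp (by positivity)))

/-- **ROW B3.b-inst, BOTH LAWS DISCHARGED BY NAME**: from the bond-level data of the transporters — `‖R^{(k)}_ν(i) − 1‖ ≤ α/n_k` and the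
two-level consistency `θ k ≤ θ₀·L^{−k}` of the (1.7)-contour transporters at the block parents (node NE3's currency) —
`PerturbationLaws (Δ_a ⊗ 1) (a·n_k^d·(Q_k(R_k)ᴴQ_k(R_k) − (Q_kᴴQ_k) ⊗ 1)) (J ⊗ 1) κ_Q (C₂^Q·L^{−k})` with `κ_Q = kappaQ d a a ε(α)`,
`C₂^Q = a·C2gram Cst 1 ε(α) (2dCst) CJ Cst (Cst·card o·(θ₀ + e^{(d+1)α} − 1))`. [cite: Balaban1984PropagatorsI, (1.7) p.20, (1.18) p.20,
Prop. 1.1 (1.89) p.33; Balaban1985BackgroundPropagators, (3.16) p.393, (3.26) p.395; King1986, (2.10) p.653, p.664] [folklore] -/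
theorem perturbationLaws_covariantAveraging_balaban_of_bond {R : (k : ℕ) → Fin d → (idx L M k → Matrix o o ℂ)} {α θ₀ : ℝ}
    {θ : ℕ → ℝ} (hα : 0 ≤ α) (hR : ∀ k ν i, ‖R k ν i - 1‖ ≤ α / (lev L k : ℕ)) (hθ : ∀ k, 0 ≤ θ k)
    (hθg : ∀ k, θ k ≤ θ₀ * ((L : ℝ)⁻¹) ^ k)
    (hT2 : ∀ (k : ℕ) (y : Tor M) (μ : Fin d) (j : Fin d → Fin (lev L k)) (r : Fin d → Fin L) (t' : ℕ), t' < L * lev L k →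
      ‖ctr M (L * lev L k) (R (k + 1)) y (glue (lev L k) L (j, r)) μ t' - ctr M (lev L k) (R k) y j μ (((r μ : ℕ) + t') / L)‖ ≤ θ k) :
    PerturbationLaws (fun k => calDalev L M a ha k ⊗ₖ (1 : Matrix o o ℂ))
      (fun k => (a : ℂ) • ((((lev L k : ℕ) : ℂ) ^ d) • ((QcovLev L M R k)ᴴ * QcovLev L M R k
          - ((QvOp (lev L k) M)ᴴ * QvOp (lev L k) M) ⊗ₖ (1 : Matrix o o ℂ))))
      (fun k => JpcT L M k ⊗ₖ (1 : Matrix o o ℂ)) (kappaQ d a (a : ℂ) ((Fintype.card o * (Real.exp ((d + 1 : ℕ) * α) - 1))))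
      (fun k => a * C2gram (Cst d a) 1 ((Fintype.card o * (Real.exp ((d + 1 : ℕ) * α) - 1))) (2 * d * Cst d a) (CJ d a) (Cst d a)
        (Cst d a * Fintype.card o * (θ₀ + (Real.exp ((d + 1 : ℕ) * α) - 1))) * ((L : ℝ)⁻¹) ^ k) :=
  perturbationLaws_covariantAveraging_balaban L M a ha o (epsB_nonneg o d hα) (averagingLaws_Bfree L M a ha)
    (averagingLaws_Ecov_of_bond L M a ha hα hR hθ hθg hT2)

/-- **THE PHYSICAL VALUE `t = 1` FROM BOND DATA**, threshold `a·ε(α)(2 + ε(α))·Cst(d,a) < 1` DISPLAYED (`L ≥ 2`): the lifted King-averaged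
unit-lattice covariances of `(Δ_a^{(k)} ⊗ 1 + a·n_k^d·(Q_k(R_k)ᴴQ_k(R_k) − (Q_kᴴQ_k) ⊗ 1))⁻¹` converge with rate `L^{−k}`. [folklore] -/
theorem covariantAveraging_balaban_rate_of_bond (hL : 2 ≤ L) {R : (k : ℕ) → Fin d → (idx L M k → Matrix o o ℂ)} {α θ₀ : ℝ}
    {θ : ℕ → ℝ} (hα : 0 ≤ α) (hR : ∀ k ν i, ‖R k ν i - 1‖ ≤ α / (lev L k : ℕ)) (hθ : ∀ k, 0 ≤ θ k)
    (hθg : ∀ k, θ k ≤ θ₀ * ((L : ℝ)⁻¹) ^ k)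
    (hT2 : ∀ (k : ℕ) (y : Tor M) (μ : Fin d) (j : Fin d → Fin (lev L k)) (r : Fin d → Fin L) (t' : ℕ), t' < L * lev L k →
      ‖ctr M (L * lev L k) (R (k + 1)) y (glue (lev L k) L (j, r)) μ t' - ctr M (lev L k) (R k) y j μ (((r μ : ℕ) + t') / L)‖ ≤ θ k)
    (hsmall : a * ((Fintype.card o * (Real.exp ((d + 1 : ℕ) * α) - 1)) * (2 + (Fintype.card o * (Real.exp ((d + 1 : ℕ) * α) - 1))) * Cst d a) < 1) :
    TowerLimitRate (fun k => Qlev L M k ⊗ₖ (1 : Matrix o o ℂ)) ((L : ℝ) ^ d)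
      (fun k => (calDalev L M a ha k ⊗ₖ (1 : Matrix o o ℂ)
        + (a : ℂ) • ((((lev L k : ℕ) : ℂ) ^ d) • ((QcovLev L M R k)ᴴ * QcovLev L M R k
            - ((QvOp (lev L k) M)ᴴ * QvOp (lev L k) M) ⊗ₖ (1 : Matrix o o ℂ))))⁻¹)
      (Cpert (kappaQ d a (a : ℂ) ((Fintype.card o * (Real.exp ((d + 1 : ℕ) * α) - 1)))) (2 * d * Cst d a) (CJ d a) (a * C2gram (Cst d a) 1 ((Fintype.card o * (Real.exp ((d + 1 : ℕ) * α) - 1))) (2 * d * Cst d a)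
        (CJ d a) (Cst d a) (Cst d a * Fintype.card o * (θ₀ + (Real.exp ((d + 1 : ℕ) * α) - 1)))) 0 1)
      ((L : ℝ)⁻¹) :=
  covariantAveraging_balaban_rate L M a ha o hL (epsB_nonneg o d hα) (averagingLaws_Bfree L M a ha)
    (averagingLaws_Ecov_of_bond L M a ha hα hR hθ hθg hT2) hsmall

end Summit.QuantumFields.BalabanUV.T4Continuum.CovariantAveragingBalaban

end
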